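import Literature.NumberTheory.GelbartRogawski1991.LocalDoubledUnitarySplittingData
import Literature.NumberTheory.GelbartRogawski1991.LocalDoubledUnitarySplittingDataSplit
import Literature.NumberTheory.GelbartRogawski1991.LocalDoubledUnitaryUnramifiedCell
import Literature.NumberTheory.GelbartRogawski1991.LocalDoubledUnitaryResidueWitness
import Literature.NumberTheory.GelbartRogawski1991.LocalDoubledUnitaryUnramifiedSplit
import HarnessLib

/-!
# The local splitting data of the doubled unitary group, III: the unramified clause; the CM specialisation
# ([GelbartRogawski1991, §3.1 (3.1.3), Prop. 3.1.1]; [HarrisKudlaSweet1996, §1 (1.5), (1.15)])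

Topic `NumberTheory/GelbartRogawski1991`; namespace
`Literature.NumberTheory.GelbartRogawski1991.UnitaryDualPair.LocalSplitting` (sequel of
`LocalDoubledUnitarySplittingData`, `LocalDoubledUnitarySplittingDataSplit`). KERNEL construction: every `def` has a
body, every theorem is proved.

* L7 = K5 `L7_unramified` — THE UNRAMIFIED CLAUSE at a good non-split place: `H(𝒪_v)` fixes `1_{𝒪_v^{n+n}}` through
  `ω_v = β⁻¹ · r ∘ ι` (integral big-cell argument: L7a `L7a_residueWitness`, L7c `L7c_weylEigen`, L7d `L7d_parabolicFix`,
  L7e `L7e_chiDet_eq_one`; the standing hypotheses `IsGoodPlace` of `LocalDoubledUnitaryGoodPlace` are cofinite), and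
  L7s `L7s_unramified`, the same at a good SPLIT place. [GelbartRogawski1991, §3.1 (3.1.3) p. 456]

* the CM specialisation: for a CM field `L` (`F = L⁺ = maximalRealSubfield L`, `E = L`, `c` = complex conjugation, `δ = imagUnit L`, `d = δ²`),
a Hecke character `χ` of `L` with `χ|_{𝕀_{L⁺}} = ε_{L/L⁺}` (`IsSplittingChar L 1 χ`, [HarrisKudlaSweet1996, (1.5)]) and
the local characters `χv w := (χ.localComponent w)⁻¹`, the four local hypotheses of parts I–II are theorems
(`CMSplittingCharLocalComponents`): `isTrivialNearOne_∕isEpsilonChar_∕isSplitPair_localComponent_inv`,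
`eventually_isGoodPlace_localComponent_inv`; hence ONE local datum at every finite place `v` of `L⁺`,
`localSplittingDatumCM` (the split datum at a split place, the non-split one otherwise), with its parabolic
normalisation `localSplittingDatumCM_parabolic` and its unramified clause `localSplittingDatumCM_unramified` at the
(cofinitely many) good places — the per-place input of the finite-adelic assembly of [GelbartRogawski1991, Prop. 3.1.1].

Stage-1 cell `pub-hodgecm`, seat GR-1 (2026-08-21). Nothing in this file is a claim of the manuscripts adjudicated by that cell.

## References

* S. Gelbart, J. Rogawski, *L-functions and Fourier–Jacobi coefficients for the unitary group U(3)*, Invent. Math. 105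
  (1991), §3.1 (3.1.3) p. 456 (the unramified vector) [GelbartRogawski1991].
* M. Harris, S. S. Kudla, W. J. Sweet, *Theta dichotomy for unitary groups*, J. Amer. Math. Soc. 9 (1996), §1 (1.5),
  (1.15) [HarrisKudlaSweet1996].
* S. S. Kudla, *Splitting metaplectic covers of dual reductive pairs*, Israel J. Math. 87 (1994) 361–401, Thm 3.1 [Kudla1994].
-/

set_option autoImplicit false

noncomputable section

open NumberField IsDedekindDomain MeasureTheory Matrix
open Literature.RepresentationTheory.HeisenbergGroup
open Literature.NumberTheory.Automorphic Literature.NumberTheory.Automorphic.UnitaryGroup Literature.NumberTheory.Weil1964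
open Literature.NumberTheory.GaloisRepresentations.IsNonarchimedeanLocalField
open Literature.GroupTheory Literature.LinearAlgebra.QuadraticForm
open Literature.NumberTheory.GelbartRogawski1991.AdaptedBlocks

namespace Literature.NumberTheory.GelbartRogawski1991.UnitaryDualPair.LocalSplitting

section Unramified

variable (F : Type) [Field F] [NumberField F] (E : Type) [Field E] [NumberField E] [Algebra F E]
  [Algebra.IsQuadraticExtension F E] (c : E ≃ₐ[F] E)
  {δ : E} (hcδ : c δ = -δ) (hδ : δ ≠ 0) {d : F} (hd : δ * δ = algebraMap F E d)
  (v : HeightOneSpectrum (𝓞 F))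
  [MeasurableSpace (v.adicCompletion F)] [BorelSpace (v.adicCompletion F)]
  (μ : Measure (v.adicCompletion F)) [μ.IsAddHaarMeasure]

section Doubled

variable (n : ℕ) {T₀ : Matrix (Fin n) (Fin n) F}

/-! ### L7 = K5 — the unramified clause at a good place -/

/-! The standing hypotheses `IsGoodPlace F E δ v n T₀ χv` are the TREE structure of `LocalDoubledUnitaryGoodPlace`
(place-uniform; cofinite by `eventually_isGoodPlace`). Bridges to the `E ⊗ F_v`-vocabulary of the local files: -/

omit [Algebra.IsQuadraticExtension F E] [MeasurableSpace (HeightOneSpectrum.adicCompletion F v)]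
  [BorelSpace (HeightOneSpectrum.adicCompletion F v)] in
/-- the `w`-entries of `T₀ ⊗ 1 ∈ M_n(E ⊗ F_v)` are those of `T₀` read in `E_w`. [cite: GelbartRogawski1991, §3.1 (3.1.3) p. 456] -/
theorem gramS_apply_eq (w : PlacesOver E v) (i j : Fin n) :
    gramS F E v n T₀ i j w = algebraMap E (w.1.adicCompletion E) (algebraMap F E (T₀ i j)) := by
  simp only [gramS, Matrix.map_apply, toLocalRing_apply]
  exact toPlace_coe v w (T₀ i j)

omit [Algebra.IsQuadraticExtension F E] [MeasurableSpace (HeightOneSpectrum.adicCompletion F v)]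
  [BorelSpace (HeightOneSpectrum.adicCompletion F v)] in
/-- `IsGoodPlace.gram` as `IsIntegralAt F E v w (T₀ ⊗ 1)`. [cite: GelbartRogawski1991, §3.1 (3.1.3) p. 456] -/
theorem IsGoodPlace.gramS_integral {χv : ∀ w : PlacesOver E v, (w.1.adicCompletion E)ˣ →* ℂˣ}
    (hgood : IsGoodPlace F E δ v n T₀ χv) (w : PlacesOver E v) : IsIntegralAt F E v w (gramS F E v n T₀) := by
  intro i j
  rw [Matrix.map_apply, Pi.evalRingHom_apply, gramS_apply_eq]
  exact hgood.gram w i j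

omit [Algebra.IsQuadraticExtension F E] [MeasurableSpace (HeightOneSpectrum.adicCompletion F v)]
  [BorelSpace (HeightOneSpectrum.adicCompletion F v)] in
/-- `IsGoodPlace.gramDet` as `|det (T₀ ⊗ 1)_w| = 1`. [cite: GelbartRogawski1991, §3.1 (3.1.3) p. 456] -/
theorem IsGoodPlace.gramS_det {χv : ∀ w : PlacesOver E v, (w.1.adicCompletion E)ˣ →* ℂˣ}
    (hgood : IsGoodPlace F E δ v n T₀ χv) (w : PlacesOver E v) :
    ValuativeRel.valuation (w.1.adicCompletion E) ((gramS F E v n T₀).det w) = 1 := by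
  have hM : (gramS F E v n T₀).map (Pi.evalRingHom (fun w' : PlacesOver E v => w'.1.adicCompletion E) w) =
      (T₀.map (algebraMap F E)).map (algebraMap E (w.1.adicCompletion E)) :=
    Matrix.ext fun i j => gramS_apply_eq F E v n w i j
  have e : (gramS F E v n T₀).det w = algebraMap E (w.1.adicCompletion E) (algebraMap F E T₀.det) := by
    rw [RingHom.map_det, RingHom.map_det, RingHom.mapMatrix_apply, RingHom.mapMatrix_apply, ← hM, ← RingHom.mapMatrix_apply,
      ← RingHom.map_det]; rfl
  rw [e]; exact hgood.gramDet w

include hcδ hδ in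
omit [MeasurableSpace (HeightOneSpectrum.adicCompletion F v)] [BorelSpace (HeightOneSpectrum.adicCompletion F v)] in
/-- **L7a (tree bricks `Automorphic/UnitaryGroupDoubledSiegelWitness`,
`Automorphic/IntegralMatrixReduction`, `Automorphic/UnitaryGroupDoubledIntegralWitness`,
`GelbartRogawski1991/LocalDoubledUnitaryResidueWitness`) — THE RESIDUE WITNESS**: every `k ∈ H(𝒪_v)` has an integral
`T₀`-skew `y` with `A_k + y C_k ∈ GL_n(𝒪_w)` (adapted blocks over `E ⊗ F_v`). Route: at the one place `w`, `E ⊗ F_v = E_w`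
and `c ⊗ 1 = c_w` (an involution preserving `|·|_w`); reduce the adapted matrix of `k` modulo `𝔭_w`
(`IntegralMatrixReduction`) to `Ȳ ∈ U(c̄_w, antidiag(2T̄₀, 2T̄₀))(𝓀_w)`; the FIELD witness over `𝓀_w`
(`exists_skew_isUnit_block₁₁_add`, θ̄ = δ̄ ≠ 0 since `|δ|_w = 1`); lift `ȳ` and skew-symmetrise
`y = ½(y₁ − T⁻¹ y₁ᴴ T)` (still reducing to `ȳ`), so `det (A_k + y C_k)` is a `w`-unit. Uses the fields `two`, `delta`,
`gram`, `gramDet` of `IsGoodPlace`. [GelbartRogawski1991, §3.1 (3.1.3); Kudla1994, §3] [cite: GelbartRogawski1991, §3.1 (3.1.3) p. 456] -/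
theorem L7a_residueWitness (hT₀ : T₀.IsSymm) {JD : Matrix (Fin (n + n)) (Fin (n + n)) E} (hJD : JD = (gramD F n T₀).map (algebraMap F E))
    (w : PlacesOver E v) (hw : c • w.1 = w.1)
    (χv : ∀ w : PlacesOver E v, (w.1.adicCompletion E)ˣ →* ℂˣ) (hgood : IsGoodPlace F E δ v n T₀ χv)
    (k : UnitaryGroup.localPi E c (n + n) JD v) (hk : k ∈ UnitaryGroup.localInt E c (n + n) JD v) :
    ∃ y : Matrix (Fin n) (Fin n) (LocalRing E v),
      (y.map (conjLocal E c v))ᵀ * gramS F E v n T₀ + gramS F E v n T₀ * y = 0 ∧ IsIntegralAt F E v w y ∧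
      IsUnit (blkA (matA F E c v n k) + y * blkC (matA F E c v n k)).det ∧
      IsIntegralAt F E v w (blkA (matA F E c v n k) + y * blkC (matA F E c v n k))⁻¹ :=
  exists_residueWitness F E c hcδ hδ v n hT₀ hJD w hw (hgood.two w) (hgood.delta w) (hgood.gramS_integral F E v n w) (hgood.gramS_det F E v n w) k hk

omit [MeasurableSpace (HeightOneSpectrum.adicCompletion F v)] [BorelSpace (HeightOneSpectrum.adicCompletion F v)] in
/-- `β_{T^𝔻_v}(·, y)` is continuous. [cite: MoeglinVignerasWaldspurger1987, Chap. 2 I.4] -/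
theorem continuous_localPairingD_left (y : Fin (n + n) → (HeightOneSpectrum.adicCompletion F v)) :
    Continuous fun u : Fin (n + n) → (HeightOneSpectrum.adicCompletion F v) => localPairing F (n + n) (gramD F n T₀) v u y := by
  simp only [Matrix.toLinearMap₂'_apply', dotProduct]
  exact continuous_finsetSum _ fun i _ => (continuous_apply i).mul continuous_const

include μ in
/-- **L7c (tree `ImplementerSection.exists_apply_integersIndicator_eq_smul_of_mapsTo` +
`iota_mapsTo_integral`) — `1_𝒪` IS AN EIGENVECTOR OF `r(ι w_Δ)`** at a good place: `ι(w_Δ)` preserves the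
lattice `𝒪_v^N × 𝒪_v^N` (`w_Δ ∈ H(𝒪_v)`, lattice lemma), hence is `transportSp` of an element of `Sp_{2N}(𝒪_v)`, and every
implementer of such an element has `1_𝒪` as an eigenvector (`ψ_v` of conductor `𝒪_v`, `½ ∈ 𝒪_v`, `T^𝔻 ∈ GL(𝒪_v)`).
[MoeglinVignerasWaldspurger1987, Chap. 2 II.10; GelbartRogawski1991, §3.1 (3.1.3)] [cite: MoeglinVignerasWaldspurger1987, Chap. 2 II.10] -/
theorem L7c_weylEigen (hT₀ : T₀.IsSymm) (hT₀d : IsUnit T₀.det) {JD : Matrix (Fin (n + n)) (Fin (n + n)) E} (hJD : JD = (gramD F n T₀).map (algebraMap F E))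
    (w : PlacesOver E v) (hw : c • w.1 = w.1)
    (χv : ∀ w : PlacesOver E v, (w.1.adicCompletion E)ˣ →* ℂˣ) (hgood : IsGoodPlace F E δ v n T₀ χv)
    (hU : ImplementerUniqueUpToScalar (localSchrodinger F (n + n) (gramD F n T₀) v))
    (r : ImplementerSection (localSchrodinger F (n + n) (gramD F n T₀) v)) :
    ∃ s : ℂ, r (iotaD F E c hcδ hδ hd v n hT₀ hJD (weylDelta F E c v n hJD)) (unitVec F (Fin (n + n)) v) =
      s • unitVec F (Fin (n + n)) v := by
  have hgi := iota_mapsTo_integral F E c hcδ hδ hd v (n + n) (gramD_isSymm F n hT₀) hJD hgood.two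
    hgood.delta (weylDelta_mem_localInt F E c hcδ hδ v n hJD (T₀ := T₀) w hw (hgood.two w))
  obtain ⟨s, hs⟩ := ImplementerSection.exists_apply_integersIndicator_eq_smul_of_mapsTo (localGram F (n + n) (gramD F n T₀) v)
    (isUnit_det_localGram F (n + n) (gramD F n T₀) (isUnit_det_gramD F n hT₀d) v)
    (isLocallyConstant_of_isContinuousNontrivial (isContinuousNontrivial_adeleAddCharAt F v))
    (continuous_localPairingD_left F v n) μ (unitVec F (Fin (n + n)) v) (coe_unitVec_eq_indicator_piPrimePowBall F (n + n) v)
    (isContinuousNontrivial_adeleAddCharAt F v) hgood.psi hgood.twoF hgood.gramF hgood.gramFinv hU r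
    (iotaD F E c hcδ hδ hd v n hT₀ hJD (weylDelta F E c v n hJD)) (fun x hx => hgi hx)
  exact ⟨(s : ℂ), hs⟩

/-- **L7d (tree `apply_integersIndicator_eq_self_of_parabolic_of_mapsTo` + `δ_Δ` of
`LeraySectionUnramifiedParabolic`) — THE PARABOLIC OPERATORS FIX `1_𝒪`** at a good place (split or not): `r(ι p) 1_𝒪 = 1_𝒪` for `p ∈ P_Δ(F_v) ∩ H(𝒪_v)`
(`ℓ_Δ = δ_Δ ℓ_Y` with `δ_Δ` integral; rigidity `r(ι p) = r_Y(δ_Δ) r_Y(q) r_Y(δ_Δ)⁻¹`, `q = m(a)n(c)` integral; the integral Levi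
and unipotent operators and `r_Y(δ_Δ)` fix `1_𝒪` up to the scalar that cancels).
[MoeglinVignerasWaldspurger1987, Chap. 2 II.6, II.10; Rangarao1993, Thm 3.5] [cite: MoeglinVignerasWaldspurger1987, Chap. 2 II.10] -/
theorem L7d_parabolicFix (hT₀ : T₀.IsSymm) (hT₀d : IsUnit T₀.det) {JD : Matrix (Fin (n + n)) (Fin (n + n)) E} (hJD : JD = (gramD F n T₀).map (algebraMap F E))
    (χv : ∀ w : PlacesOver E v, (w.1.adicCompletion E)ˣ →* ℂˣ) (hgood : IsGoodPlace F E δ v n T₀ χv)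
    (hU : ImplementerUniqueUpToScalar (localSchrodinger F (n + n) (gramD F n T₀) v))
    (r : ImplementerSection (localSchrodinger F (n + n) (gramD F n T₀) v))
    (hr : ∀ g₁ g₂ : LocalSp F (n + n) (gramD F n T₀) v, r.cocycle hU g₁ g₂ =
      localLeray F (n + n) (gramD F n T₀) (isUnit_det_gramD F n hT₀d) v μ ((adeleAddCharAt F v).mulShift (⅟(2 : (HeightOneSpectrum.adicCompletion F v))))
        (isContinuousNontrivial_adeleAddCharAt_half F v) (deltaLagrangian F v n) (deltaLagrangian_orthogonal F v n T₀ hT₀d) g₁ g₂)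
    (p : UnitaryGroup.localPi E c (n + n) JD v) (hp : p ∈ UnitaryGroup.localInt E c (n + n) JD v)
    (hpΔ : IsSiegelDelta F E c hcδ hδ hd v n hT₀ hJD p) :
    r (iotaD F E c hcδ hδ hd v n hT₀ hJD p) (unitVec F (Fin (n + n)) v) = unitVec F (Fin (n + n)) v := by
  obtain ⟨δ', hδ'i, hδ'⟩ := exists_integral_isometry_map_lagrangianY_eq_deltaLagrangian F v n T₀ hT₀ hgood.twoF
  have hgi := iota_mapsTo_integral F E c hcδ hδ hd v (n + n) (gramD_isSymm F n hT₀) hJD hgood.two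
    hgood.delta hp
  have hr' : r.cocycle hU = localLeray F (n + n) (gramD F n T₀) (isUnit_det_gramD F n hT₀d) v μ
      ((adeleAddCharAt F v).mulShift (⅟(2 : (HeightOneSpectrum.adicCompletion F v)))) (isContinuousNontrivial_adeleAddCharAt_half F v) (deltaLagrangian F v n)
      (deltaLagrangian_orthogonal F v n T₀ hT₀d) := CentralCocycle.ext fun g₁ g₂ => hr g₁ g₂
  exact apply_integersIndicator_eq_self_of_parabolic_of_mapsTo (localGram F (n + n) (gramD F n T₀) v)
    (isUnit_det_localGram F (n + n) (gramD F n T₀) (isUnit_det_gramD F n hT₀d) v)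
    (isLocallyConstant_of_isContinuousNontrivial (isContinuousNontrivial_adeleAddCharAt F v))
    (continuous_localPairingD_left F v n) μ (unitVec F (Fin (n + n)) v) (coe_unitVec_eq_indicator_piPrimePowBall F (n + n) v)
    (isContinuousNontrivial_adeleAddCharAt F v) hgood.psi hgood.twoF hgood.gramF hgood.gramFinv hU r
    (deltaLagrangian_orthogonal F v n T₀ hT₀d) hr' δ' hδ'i hδ' (iotaD F E c hcδ hδ hd v n hT₀ hJD p) hpΔ (fun x hx => hgi hx)

omit [MeasurableSpace (HeightOneSpectrum.adicCompletion F v)] [BorelSpace (HeightOneSpectrum.adicCompletion F v)] in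
/-- **L7e (tree brick `LocalDoubledUnitaryUnramifiedParabolic`) — `χ_v(det_Δ p) = 1` on
`P_Δ ∩ H(𝒪_v)`** at a good place: `det p_w = det (a + b) · det (d − b)` for the `e₂`-blocks of `p_w` (Siegel condition
`a + b = c + d`), both factors integral and `det p_w ∈ 𝒪_w^×`, so `det_Δ p ∈ 𝒪_w^×`; `χ_w` unramified. Only the field
`chi` of `IsGoodPlace` is used. [GelbartRogawski1991, §3.1 (3.1.2)–(3.1.3)] [cite: GelbartRogawski1991, §3.1 (3.1.3) p. 456] -/
theorem L7e_chiDet_eq_one (hT₀ : T₀.IsSymm) {JD : Matrix (Fin (n + n)) (Fin (n + n)) E} (hJD : JD = (gramD F n T₀).map (algebraMap F E))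
    (χv : ∀ w : PlacesOver E v, (w.1.adicCompletion E)ˣ →* ℂˣ) (hgood : IsGoodPlace F E δ v n T₀ χv)
    (p : UnitaryGroup.localPi E c (n + n) JD v) (hp : p ∈ UnitaryGroup.localInt E c (n + n) JD v)
    (hpΔ : IsSiegelDelta F E c hcδ hδ hd v n hT₀ hJD p) : chiDet F E c v n χv p = 1 :=
  chiDet_eq_one_of_mem_localInt F E c hcδ hδ hd v n hT₀ hJD χv hgood.chi hp hpΔ

omit [MeasurableSpace (HeightOneSpectrum.adicCompletion F v)] [BorelSpace (HeightOneSpectrum.adicCompletion F v)] in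
/-- `1_𝒪 ≠ 0`. [cite: MoeglinVignerasWaldspurger1987, Chap. 2 II.10] -/
theorem unitVec_ne_zero : unitVec F (Fin (n + n)) v ≠ 0 := by
  intro h
  have h1 := congrArg (fun Φ : SchwartzBruhat (Fin (n + n) → (HeightOneSpectrum.adicCompletion F v)) => (Φ : (Fin (n + n) → (HeightOneSpectrum.adicCompletion F v)) → ℂ) 0) h
  simp only [ZeroMemClass.coe_zero, Pi.zero_apply] at h1
  rw [unitVec_apply_of_mem] at h1
  · exact one_ne_zero h1
  · simp [integralBox]

/-- **L7 (K5) — THE UNRAMIFIED CLAUSE at a good non-split place (from L7a∕L7c∕L7d∕L7e)**: `H(𝒪_v)` fixes `1_𝒪`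
through `ω_v = β⁻¹ · r ∘ ι` — the integral big-cell argument (tree `LocalDoubledUnitaryUnramifiedCell.omega_eq_self_of_residueWitness`,
`ImplementerOmegaEigen`): no generation statement for `H(𝒪_v)` and no value of `β` off `P_Δ` is used.
[GelbartRogawski1991, §3.1 (3.1.3) p. 456; MoeglinVignerasWaldspurger1987, Chap. 2 II.10] [cite: GelbartRogawski1991, §3.1 (3.1.3) p. 456; MoeglinVignerasWaldspurger1987, Chap. 2 II.10] -/
theorem L7_unramified (hT₀ : T₀.IsSymm) (hT₀d : IsUnit T₀.det) {JD : Matrix (Fin (n + n)) (Fin (n + n)) E} (hJD : JD = (gramD F n T₀).map (algebraMap F E))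
    (w : PlacesOver E v) (hw : c • w.1 = w.1)
    (χv : ∀ w : PlacesOver E v, (w.1.adicCompletion E)ˣ →* ℂˣ) (hχ : IsEpsilonChar F E v d w (χv w))
    (hχ1 : IsTrivialNearOne F E v w (χv w)) (hgood : IsGoodPlace F E δ v n T₀ χv) :
    ∀ k ∈ UnitaryGroup.localInt E c (n + n) JD v,
      (localSplittingDatumNonsplit F E c hcδ hδ hd v μ n hT₀ hT₀d hJD w hw χv hχ hχ1).localOmega k
          (unitVec F (Fin (n + n)) v) = unitVec F (Fin (n + n)) v := by
  set D := localSplittingDatumNonsplit F E c hcδ hδ hd v μ n hT₀ hT₀d hJD w hw χv hχ hχ1 with hD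
  have hr : ∀ g₁ g₂ : LocalSp F (n + n) (gramD F n T₀) v, D.r.cocycle D.hU g₁ g₂ =
      localLeray F (n + n) (gramD F n T₀) (isUnit_det_gramD F n hT₀d) v μ ((adeleAddCharAt F v).mulShift (⅟(2 : (HeightOneSpectrum.adicCompletion F v))))
        (isContinuousNontrivial_adeleAddCharAt_half F v) (deltaLagrangian F v n) (deltaLagrangian_orthogonal F v n T₀ hT₀d) g₁ g₂ :=
    (L0D F v μ n hT₀d).cocycle_eq
  have hβP : ∀ p, IsSiegelDelta F E c hcδ hδ hd v n hT₀ hJD p → D.beta p = chiDet F E c v n χv p :=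
    beta_parabolic F E c hcδ hδ hd v μ n hT₀ hT₀d hJD w hw χv hχ hχ1
  intro k hk
  rw [LocalSplittingDatum.localOmega_apply]
  change D.r.omega (iotaD F E c hcδ hδ hd v n hT₀ hJD) D.beta k (unitVec F (Fin (n + n)) v) = unitVec F (Fin (n + n)) v
  refine omega_eq_self_of_residueWitness F E c hcδ hδ hd v n hT₀ hT₀d hJD w hw (hgood.two w) D.hU D.r D.beta D.beta_mul
    (unitVec_ne_zero F v n) ?_ ?_ ?_ k hk
  · obtain ⟨s, hs⟩ := L7c_weylEigen F E c hcδ hδ hd v μ n hT₀ hT₀d hJD w hw χv hgood D.hU D.r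
    exact ⟨(((D.beta (weylDelta F E c v n hJD))⁻¹ : ℂˣ) : ℂ) * s, by
      rw [ImplementerSection.omega_apply, hs, Units.smul_def, smul_smul]⟩
  · intro p hp hpΔ
    rw [ImplementerSection.omega_apply, hβP p hpΔ, L7e_chiDet_eq_one F E c hcδ hδ hd v n hT₀ hJD χv hgood p hp hpΔ,
      inv_one, one_smul]
    exact L7d_parabolicFix F E c hcδ hδ hd v μ n hT₀ hT₀d hJD χv hgood D.hU D.r hr p hp hpΔ
  · exact fun k hk => L7a_residueWitness F E c hcδ hδ v n hT₀ hJD w hw χv hgood k hk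

omit [Algebra.IsQuadraticExtension F E] [MeasurableSpace (HeightOneSpectrum.adicCompletion F v)]
  [BorelSpace (HeightOneSpectrum.adicCompletion F v)] in
/-- `IsGoodPlace.gram ∕ gramDet` in the `E_w`-vocabulary (`gramW`) of the split-place files. [cite: GelbartRogawski1991, §3.1 (3.1.3) p. 456] -/
theorem IsGoodPlace.gramW_integral {χv : ∀ w : PlacesOver E v, (w.1.adicCompletion E)ˣ →* ℂˣ}
    (hgood : IsGoodPlace F E δ v n T₀ χv) (w : PlacesOver E v) :
    (∀ i j, ValuativeRel.valuation (w.1.adicCompletion E) (gramW F E v n (T₀ := T₀) w i j) ≤ 1) ∧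
      ValuativeRel.valuation (w.1.adicCompletion E) (gramW F E v n (T₀ := T₀) w).det = 1 := by
  refine ⟨fun i j => hgood.gram w i j, ?_⟩
  have e : (gramW F E v n (T₀ := T₀) w).det = algebraMap E (w.1.adicCompletion E) (algebraMap F E T₀.det) := by
    rw [RingHom.map_det, RingHom.map_det, RingHom.mapMatrix_apply, RingHom.mapMatrix_apply]
  rw [e]; exact hgood.gramDet w

/-- **L7s = K5 AT A SPLIT PLACE — THE UNRAMIFIED CLAUSE at a good split place**: `H(𝒪_v) ≅ GL_{2n}(𝒪_w)`
fixes `1_𝒪` through `ω_v = β⁻¹ · r ∘ ι` of the split datum. Route: the integral big-cell argument inside `H(𝒪_v)` (tree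
`LocalDoubledUnitaryUnramifiedSplit.omega_eq_self_of_glWitness_split`: residue witness = integral big cell of `GL_{2n}(𝒪_w)`,
`Automorphic/GLIntegralBigCellWitness`), `ω(w_Δ) 1_𝒪 ∈ ℂ 1_𝒪` (lattice lemma + `exists_apply_integersIndicator_eq_smul_of_mapsTo`),
and on `P_Δ ∩ H(𝒪_v)`: `β(p) = λ_m(ιp)·χ_w(det p_w) = 1·1` (`betaSplit_eq_one_of_map_eq`, `χ_w` unramified), `r(ιp) 1_𝒪 = 1_𝒪`
(L7d, place-independent). [GelbartRogawski1991, §3.1 (3.1.3) p. 456; MoeglinVignerasWaldspurger1987, Chap. 2 II.10] [cite: GelbartRogawski1991, §3.1 (3.1.3) p. 456; MoeglinVignerasWaldspurger1987, Chap. 2 II.10] -/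
theorem L7s_unramified (hT₀ : T₀.IsSymm) (hT₀d : IsUnit T₀.det) {JD : Matrix (Fin (n + n)) (Fin (n + n)) E} (hJD : JD = (gramD F n T₀).map (algebraMap F E))
    (w : PlacesOver E v) (hw : c • w.1 ≠ w.1)
    (χv : ∀ w : PlacesOver E v, (w.1.adicCompletion E)ˣ →* ℂˣ) (hχ1 : IsTrivialNearOne F E v w (χv w))
    (hgood : IsGoodPlace F E δ v n T₀ χv) :
    ∀ k ∈ UnitaryGroup.localInt E c (n + n) JD v,
      (localSplittingDatumSplit F E c hcδ hδ hd v μ n hT₀ hT₀d hJD w hw χv hχ1).localOmega k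
          (unitVec F (Fin (n + n)) v) = unitVec F (Fin (n + n)) v := by
  set D := localSplittingDatumSplit F E c hcδ hδ hd v μ n hT₀ hT₀d hJD w hw χv hχ1 with hD
  have hr : ∀ g₁ g₂ : LocalSp F (n + n) (gramD F n T₀) v, D.r.cocycle D.hU g₁ g₂ =
      localLeray F (n + n) (gramD F n T₀) (isUnit_det_gramD F n hT₀d) v μ ((adeleAddCharAt F v).mulShift (⅟(2 : (HeightOneSpectrum.adicCompletion F v))))
        (isContinuousNontrivial_adeleAddCharAt_half F v) (deltaLagrangian F v n) (deltaLagrangian_orthogonal F v n T₀ hT₀d) g₁ g₂ :=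
    (L0D F v μ n hT₀d).cocycle_eq
  obtain ⟨hTw, hTwd⟩ := hgood.gramW_integral F E v n w
  intro k hk
  rw [LocalSplittingDatum.localOmega_apply]
  change D.r.omega (iotaD F E c hcδ hδ hd v n hT₀ hJD) D.beta k (unitVec F (Fin (n + n)) v) = unitVec F (Fin (n + n)) v
  refine omega_eq_self_of_glWitness_split F E c hcδ hδ hd v n hT₀ hT₀d hJD w hw hTw hTwd (hgood.two w) D.hU D.r D.beta D.beta_mul
    (unitVec_ne_zero F v n) ?_ ?_ k hk
  · -- `ω(w_Δ) 1_𝒪 ∈ ℂ 1_𝒪`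
    have hgi := iota_mapsTo_integral F E c hcδ hδ hd v (n + n) (gramD_isSymm F n hT₀) hJD hgood.two hgood.delta
      (weylSplit_mem_localInt F E c hcδ hδ v n hT₀ hT₀d hJD w hw hTw hTwd (hgood.two w))
    obtain ⟨s, hs⟩ := ImplementerSection.exists_apply_integersIndicator_eq_smul_of_mapsTo (localGram F (n + n) (gramD F n T₀) v)
      (isUnit_det_localGram F (n + n) (gramD F n T₀) (isUnit_det_gramD F n hT₀d) v)
      (isLocallyConstant_of_isContinuousNontrivial (isContinuousNontrivial_adeleAddCharAt F v))
      (continuous_localPairingD_left F v n) μ (unitVec F (Fin (n + n)) v) (coe_unitVec_eq_indicator_piPrimePowBall F (n + n) v)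
      (isContinuousNontrivial_adeleAddCharAt F v) hgood.psi hgood.twoF hgood.gramF hgood.gramFinv D.hU D.r
      (iotaD F E c hcδ hδ hd v n hT₀ hJD (weylSplit F E c hcδ hδ v n hT₀ hT₀d hJD w hw)) (fun x hx => hgi hx)
    exact ⟨(((D.beta (weylSplit F E c hcδ hδ v n hT₀ hT₀d hJD w hw))⁻¹ : ℂˣ) : ℂ) * s, by
      rw [ImplementerSection.omega_apply, hs, Units.smul_def, smul_smul]⟩
  · -- `P_Δ(F_v) ∩ H(𝒪_v)` fixes `1_𝒪`
    intro p hp hpΔ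
    have hβ1 : D.beta p = 1 := by
      change betaSplitDoubled F E c hcδ hδ hd v μ n hT₀ hT₀d hJD w hw (L0D F v μ n hT₀d).hψ' χv p = 1
      rw [betaSplitDoubled, betaSplit_eq_one_of_map_eq F E c hcδ hδ hd v μ (n + n) (gramD F n T₀) (gramD_isSymm F n hT₀)
        (isUnit_det_gramD F n hT₀d) hJD (L0D F v μ n hT₀d).hψ' (deltaLagrangian_orthogonal F v n T₀ hT₀d) w hw p hpΔ, one_mul]
      refine hgood.chi w _ ?_
      rw [Matrix.GeneralLinearGroup.val_det_apply]
      exact valuation_det_eq_one_of_mem_glInt' F E v w ((mem_localInt_iff E c (n + n) JD v p).1 hp w)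
    rw [ImplementerSection.omega_apply, hβ1, inv_one, one_smul]
    exact L7d_parabolicFix F E c hcδ hδ hd v μ n hT₀ hT₀d hJD χv hgood D.hU D.r hr p hp hpΔ

end Doubled

end Unramified

section CM

open Literature.RepresentationTheory.HarrisKudlaSweet1996 Literature.NumberTheory.GaloisRepresentations

variable (L : Type) [Field L] [NumberField L] [IsCMField L]
  (v : HeightOneSpectrum (𝓞 (maximalRealSubfield L)))
  [MeasurableSpace (v.adicCompletion (maximalRealSubfield L))] [BorelSpace (v.adicCompletion (maximalRealSubfield L))]
  (μ : Measure (v.adicCompletion (maximalRealSubfield L))) [μ.IsAddHaarMeasure]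
  (n : ℕ) {T₀ : Matrix (Fin n) (Fin n) (maximalRealSubfield L)}

omit [IsCMField L] [MeasurableSpace (v.adicCompletion (maximalRealSubfield L))]
  [BorelSpace (v.adicCompletion (maximalRealSubfield L))] in
/-- `χ_w⁻¹` is trivial near `1` (every place). [cite: HarrisKudlaSweet1996, §1 (1.5), (1.15)] -/
theorem isTrivialNearOne_localComponent_inv (χ : HeckeCharacter L)
    (w : PlacesOver L v) :
    IsTrivialNearOne (maximalRealSubfield L) L v w (χ.localComponent w.1)⁻¹ :=
  eventually_localComponent_inv_unit_eq_one χ w.1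

omit [MeasurableSpace (v.adicCompletion (maximalRealSubfield L))] [BorelSpace (v.adicCompletion (maximalRealSubfield L))] in
/-- at a NON-SPLIT place `χ_w⁻¹|_{F_v^×}` is the quadratic character `(δ², ·)_v` (`IsEpsilonChar`). [cite: HarrisKudlaSweet1996, §1 (1.5), (1.15)] -/
theorem isEpsilonChar_localComponent_inv (χ : HeckeCharacter L) (hχ : IsSplittingChar L 1 χ)
    (w : PlacesOver L v) (hw : IsCMField.complexConj L • w.1 = w.1) :
    IsEpsilonChar (maximalRealSubfield L) L v (imagUnitSq L) w (χ.localComponent w.1)⁻¹ :=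
  fun a => localComponent_inv_toPlace_eq_hilbertSymbol χ hχ w hw a

omit [MeasurableSpace (v.adicCompletion (maximalRealSubfield L))] [BorelSpace (v.adicCompletion (maximalRealSubfield L))] in
/-- at a SPLIT place the two components are tied (`IsSplitPair`). [cite: HarrisKudlaSweet1996, §1 (1.5), (1.15)] -/
theorem isSplitPair_localComponent_inv (χ : HeckeCharacter L) (hχ : IsSplittingChar L 1 χ)
    (w : PlacesOver L v) (hw : IsCMField.complexConj L • w.1 ≠ w.1) :
    IsSplitPair (maximalRealSubfield L) L (IsCMField.complexConj L) v w
      (fun w' : PlacesOver L v => (χ.localComponent w'.1)⁻¹) :=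
  fun x => localComponent_galInv_inv_eq χ hχ w hw x

omit [MeasurableSpace (v.adicCompletion (maximalRealSubfield L))] [BorelSpace (v.adicCompletion (maximalRealSubfield L))] in
/-- the good places are cofinite for the family `χv w := χ_w⁻¹`. [cite: GelbartRogawski1991, §3.1 (3.1.3) p. 456] -/
theorem eventually_isGoodPlace_localComponent_inv (hT₀d : IsUnit T₀.det) (χ : HeckeCharacter L)
    :
    ∀ᶠ v : HeightOneSpectrum (𝓞 (maximalRealSubfield L)) in Filter.cofinite,
      IsGoodPlace (maximalRealSubfield L) L (imagUnit L) v n T₀ (fun w : PlacesOver L v => (χ.localComponent w.1)⁻¹) :=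
  eventually_isGoodPlace (maximalRealSubfield L) L (imagUnit L) n T₀ (imagUnit_ne_zero L) hT₀d
    (fun (v : HeightOneSpectrum (𝓞 (maximalRealSubfield L))) (w : PlacesOver L v) => (χ.localComponent w.1)⁻¹)
    (eventually_forall_placesOver_localComponent_inv_eq_one L χ)

/-- **THE LOCAL DATUM AT `v` for the CM data** : the split datum at a split place (some `w ∣ v` with
`c • w ≠ w`), the non-split datum otherwise. [cite: GelbartRogawski1991, §3.1 Prop. 3.1.1; Kudla1994, Thm 3.1] -/
def localSplittingDatumCM (hT₀ : T₀.IsSymm) (hT₀d : IsUnit T₀.det) {JD : Matrix (Fin (n + n)) (Fin (n + n)) L} (hJD : JD = (gramD (maximalRealSubfield L) n T₀).map (algebraMap (maximalRealSubfield L) L)) (χ : HeckeCharacter L) (hχ : IsSplittingChar L 1 χ)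
    :
    LocalSplittingDatum (maximalRealSubfield L) L (IsCMField.complexConj L) (n + n) (complexConj_imagUnit L)
      (imagUnit_ne_zero L) (imagUnit_mul_self L) (gramD (maximalRealSubfield L) n T₀)
      (gramD_isSymm (maximalRealSubfield L) n hT₀) (isUnit_det_gramD (maximalRealSubfield L) n hT₀d) hJD v μ
      (deltaLagrangian (maximalRealSubfield L) v n) (deltaLagrangian_orthogonal (maximalRealSubfield L) v n T₀ hT₀d) := by
  classical
  exact if h : ∃ w : PlacesOver L v, IsCMField.complexConj L • w.1 ≠ w.1 then
    localSplittingDatumSplit (maximalRealSubfield L) L (IsCMField.complexConj L) (complexConj_imagUnit L)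
      (imagUnit_ne_zero L) (imagUnit_mul_self L) v μ n hT₀ hT₀d hJD h.choose h.choose_spec
      (fun w' : PlacesOver L v => (χ.localComponent w'.1)⁻¹) (isTrivialNearOne_localComponent_inv L v χ h.choose)
  else
    localSplittingDatumNonsplit (maximalRealSubfield L) L (IsCMField.complexConj L) (complexConj_imagUnit L)
      (imagUnit_ne_zero L) (imagUnit_mul_self L) v μ n hT₀ hT₀d hJD (Classical.choice (PlacesOver.nonempty L v))
      (not_not.1 ((not_exists.1 h) (Classical.choice (PlacesOver.nonempty L v))))
      (fun w' : PlacesOver L v => (χ.localComponent w'.1)⁻¹)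
      (isEpsilonChar_localComponent_inv L v χ hχ (Classical.choice (PlacesOver.nonempty L v))
        (not_not.1 ((not_exists.1 h) (Classical.choice (PlacesOver.nonempty L v)))))
      (isTrivialNearOne_localComponent_inv L v χ (Classical.choice (PlacesOver.nonempty L v)))

/-- **THE PARABOLIC NORMALISATION of the CM datum** (L8 ∕ L8s by cases):
`(r(δ') (ω_v(p) (r(δ')⁻¹ Φ)))(0) = (∏_w χ_w⁻¹(det_Δ p_w))⁻¹ · (∏_w ‖det_Δ p_w‖_w^{1/2}) · Φ(0)`. [cite: Kudla1994, Thm 3.1; HarrisKudlaSweet1996, §1 (1.16)] -/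
theorem localSplittingDatumCM_parabolic (hT₀ : T₀.IsSymm) (hT₀d : IsUnit T₀.det) {JD : Matrix (Fin (n + n)) (Fin (n + n)) L} (hJD : JD = (gramD (maximalRealSubfield L) n T₀).map (algebraMap (maximalRealSubfield L) L)) (χ : HeckeCharacter L) (hχ : IsSplittingChar L 1 χ)
    (δ' : LocalSp (maximalRealSubfield L) (n + n) (gramD (maximalRealSubfield L) n T₀) v)
    (hδ' : (deltaLagrangian (maximalRealSubfield L) v n).map (toLin (maximalRealSubfield L) v δ') =
      lagrangianY (maximalRealSubfield L) (n + n) v)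
    (p : UnitaryGroup.localPi L (IsCMField.complexConj L) (n + n) JD v)
    (hp : IsSiegelDelta (maximalRealSubfield L) L (IsCMField.complexConj L) (complexConj_imagUnit L) (imagUnit_ne_zero L)
      (imagUnit_mul_self L) v n hT₀ hJD p)
    (Φ : SchwartzBruhat (Fin (n + n) → v.adicCompletion (maximalRealSubfield L))) :
    ((((localSplittingDatumCM L v μ n hT₀ hT₀d hJD χ hχ).r δ')
        ((localSplittingDatumCM L v μ n hT₀ hT₀d hJD χ hχ).localOmega p
          (((localSplittingDatumCM L v μ n hT₀ hT₀d hJD χ hχ).r δ').symm Φ)) :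
        SchwartzBruhat (Fin (n + n) → v.adicCompletion (maximalRealSubfield L))) :
          (Fin (n + n) → v.adicCompletion (maximalRealSubfield L)) → ℂ) 0 =
      (((chiDet (maximalRealSubfield L) L (IsCMField.complexConj L) v n
          (fun w' : PlacesOver L v => (χ.localComponent w'.1)⁻¹) p)⁻¹ : ℂˣ) : ℂ) *
        ((∏ w' : PlacesOver L v, Real.sqrt ‖detDelta (maximalRealSubfield L) L (IsCMField.complexConj L) v n w' p‖ : ℝ) : ℂ) *
        ((Φ : SchwartzBruhat (Fin (n + n) → v.adicCompletion (maximalRealSubfield L))) :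
          (Fin (n + n) → v.adicCompletion (maximalRealSubfield L)) → ℂ) 0 := by
  unfold localSplittingDatumCM
  split_ifs with h
  · exact L8s_parabolicNormalised (maximalRealSubfield L) L (IsCMField.complexConj L) (complexConj_imagUnit L)
      (imagUnit_ne_zero L) (imagUnit_mul_self L) v μ n hT₀ hT₀d hJD h.choose h.choose_spec _
      (isSplitPair_localComponent_inv L v χ hχ h.choose h.choose_spec) _ δ' hδ' p hp Φ
  · exact L8_parabolicNormalised (maximalRealSubfield L) L (IsCMField.complexConj L) (complexConj_imagUnit L)
      (imagUnit_ne_zero L) (imagUnit_mul_self L) v μ n hT₀ hT₀d hJD _ _ _ _ _ δ' hδ' p hp Φ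

/-- **THE UNRAMIFIED CLAUSE of the CM datum at a good place** (L7 ∕ L7s by cases); the good places are cofinite by
`eventually_isGoodPlace_localComponent_inv`. [cite: GelbartRogawski1991, §3.1 (3.1.3) p. 456] -/
theorem localSplittingDatumCM_unramified (hT₀ : T₀.IsSymm) (hT₀d : IsUnit T₀.det) {JD : Matrix (Fin (n + n)) (Fin (n + n)) L} (hJD : JD = (gramD (maximalRealSubfield L) n T₀).map (algebraMap (maximalRealSubfield L) L)) (χ : HeckeCharacter L) (hχ : IsSplittingChar L 1 χ)
    (hgood : IsGoodPlace (maximalRealSubfield L) L (imagUnit L) v n T₀ (fun w' : PlacesOver L v => (χ.localComponent w'.1)⁻¹)) :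
    ∀ k ∈ UnitaryGroup.localInt L (IsCMField.complexConj L) (n + n) JD v,
      (localSplittingDatumCM L v μ n hT₀ hT₀d hJD χ hχ).localOmega k
          (unitVec (maximalRealSubfield L) (Fin (n + n)) v) = unitVec (maximalRealSubfield L) (Fin (n + n)) v := by
  unfold localSplittingDatumCM
  split_ifs with h
  · exact L7s_unramified (maximalRealSubfield L) L (IsCMField.complexConj L) (complexConj_imagUnit L)
      (imagUnit_ne_zero L) (imagUnit_mul_self L) v μ n hT₀ hT₀d hJD h.choose h.choose_spec _ _ hgood
  · exact L7_unramified (maximalRealSubfield L) L (IsCMField.complexConj L) (complexConj_imagUnit L)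
      (imagUnit_ne_zero L) (imagUnit_mul_self L) v μ n hT₀ hT₀d hJD _ _ _ _ _ hgood

end CM

end Literature.NumberTheory.GelbartRogawski1991.UnitaryDualPair.LocalSplitting

end
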